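import Summits.RiemannHypothesis.RiemannHypothesis.Theorems.WeilBochnerMeasureKernelChar
import Summits.RiemannHypothesis.RiemannHypothesis.Theorems.WeilBochnerMeasureZeroFreeKernel
import Summits.RiemannHypothesis.RiemannHypothesis.Theorems.WeilBochnerMeasureSpectral
import Literature.NumberTheory.LFunctions.WeilBochnerRepresentationGRH
import Literature.NumberTheory.LFunctions.WeilExplicitDirichletProofs
import Mathlib.MeasureTheory.Integral.Bochner.ContinuousLinearMap
import HarnessLib

/-!
# RiemannHypothesis (GRH arm) — the `χ`-window measure IS the spectral side of Weil's (11) on the window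

Helper file (`--supports stmt-RiemannHypothesis-0098`), GRH-free, standard axioms.  Seat rh-explicit
weil-3 (structure).  The `χ`-twin of `WeilBochnerMeasureSpectral.lean`.

Let `μ` represent `W_χ` on the window `[-b, b]`, `b > 0` (hypothesis `hμ` as in
`WeilBochnerMeasureKernelChar.lean`).  Then:

* `weilFunctionalChar_add_of_continuous`: additivity of `W_χ` on continuous compactly supported
  kernels with integrable shifted archimedean integrands;
* `weilFunctionalChar_eq_integral_of_im_eq_zero` (hermitian tests) and
  **`integral_weilMellin_eq_weilFunctionalChar`**: for EVERY smooth test `k` with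
  `tsupport k ⊆ [-a, a]`, `a < 2b`: `k̂(½+i·) ∈ L¹(μ)` and `∫ k̂(½+it) dμ(t) = W_χ(k)` — the measure is
  the Fourier transform of Weil's distribution for `L(s, χ)` on `(-2b, 2b)`;
* `integral_weilMellin_eq_integral_weilMellin_char`: determinacy on the window;
* **`grh_iff_exists_spectral_measure`** (`χ` primitive, `q ≠ 1`): `GRH(χ) ↔ ∃ μ ≥ 0 on ℝ, ∀ tests k,
  ∫ k̂(½+it) dμ = W_χ(k)` — the Bochner form of Weil's lemma for `L(s, χ)` with the LINEAR functional.

Proofs verbatim from the `ζ` file (zero-free kernel `WeilBochnerMeasureZeroFreeKernel.lean`, which is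
character-free; `weilFunctionalChar_kernel_eq_integral`; linearity of `W_χ`).
-/

noncomputable section

set_option linter.dupNamespace false  -- the mandated namespace repeats `RiemannHypothesis`

open Complex Filter Set MeasureTheory
open scoped Real Topology ComplexConjugate
open Literature.NumberTheory.LFunctions
open Summit.RiemannHypothesis.RiemannHypothesis.Theorems.WeilBochnerMeasure

namespace Summit.RiemannHypothesis.RiemannHypothesis.Theorems.WeilBochnerMeasureChar

variable {q : ℕ} (χ : DirichletCharacter ℂ q) {b : ℝ} {μ : Measure ℝ}

/-! ## Additivity of `W_χ` on continuous kernels -/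

section Additivity

variable {g h : ℝ → ℂ}

/-- The twisted prime term is additive on compactly supported kernels (finite sums). -/
theorem weilPrimeTermChar_add (hgs : HasCompactSupport g) (hhs : HasCompactSupport h) :
    weilPrimeTermChar χ (g + h) = weilPrimeTermChar χ g + weilPrimeTermChar χ h := by
  unfold weilPrimeTermChar
  rw [← (summable_weilPrimeTermChar χ hgs).tsum_add (summable_weilPrimeTermChar χ hhs)]
  congr 1 with n
  simp only [Pi.add_apply]
  ring

/-- The shifted archimedean integral is additive when both integrands are integrable. -/
theorem weilArchIntegralChar_add (a : ℕ) (hgc : Continuous g) (hgs : HasCompactSupport g)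
    (hhc : Continuous h) (hhs : HasCompactSupport h)
    (hgA : Integrable fun t : ℝ ↦
      weilMellin g (1 / 2 + t * I) * ((Complex.digamma (1 / 4 + (a : ℂ) / 2 + t / 2 * I)).re : ℂ))
    (hhA : Integrable fun t : ℝ ↦
      weilMellin h (1 / 2 + t * I) * ((Complex.digamma (1 / 4 + (a : ℂ) / 2 + t / 2 * I)).re : ℂ)) :
    weilArchIntegralChar a (g + h) = weilArchIntegralChar a g + weilArchIntegralChar a h := by
  unfold weilArchIntegralChar
  rw [← integral_add hgA hhA]
  refine integral_congr_ae (ae_of_all _ fun t ↦ ?_)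
  simp only [weilMellin_add hgc hgs hhc hhs]
  ring

/-- **Additivity of `W_χ`** on continuous compactly supported kernels with integrable shifted
archimedean integrands: `W_χ(g + h) = W_χ(g) + W_χ(h)`. -/
theorem weilFunctionalChar_add_of_continuous (hgc : Continuous g) (hgs : HasCompactSupport g)
    (hhc : Continuous h) (hhs : HasCompactSupport h)
    (hgA : Integrable fun t : ℝ ↦ weilMellin g (1 / 2 + t * I) *
      ((Complex.digamma (1 / 4 + (charParity χ : ℂ) / 2 + t / 2 * I)).re : ℂ))
    (hhA : Integrable fun t : ℝ ↦ weilMellin h (1 / 2 + t * I) *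
      ((Complex.digamma (1 / 4 + (charParity χ : ℂ) / 2 + t / 2 * I)).re : ℂ)) :
    weilFunctionalChar χ (g + h) = weilFunctionalChar χ g + weilFunctionalChar χ h := by
  simp only [weilFunctionalChar, weilArchTermChar, weilPolarTerm_add hgc hgs hhc hhs,
    weilPrimeTermChar_add χ hgs hhs, weilArchIntegralChar_add _ hgc hgs hhc hhs hgA hhA, Pi.add_apply]
  split_ifs <;> ring

end Additivity


/-! ## The hermitian case: tests with real transform -/

/-- **Tests with real transform (χ).**  If `μ` represents `W_χ` on `[-b, b]` (`b > 0`) and `k` is a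
smooth test supported in `[-a, a]`, `a < 2b`, whose transform is real on the critical line, then
`Re k̂(½+i·) ∈ L¹(μ)` and `W_χ(k) = ∫ Re k̂(½+it) dμ(t)`. -/
theorem weilFunctionalChar_eq_integral_of_im_eq_zero (hb : 0 < b)
    (hμ : ∀ g : ℝ → ℂ, IsWeilTest g → tsupport g ⊆ Icc (-b) b →
      Integrable (fun t : ℝ ↦ ‖weilMellin g (1 / 2 + t * I)‖ ^ 2) μ ∧
        weilQuadraticChar χ g = ((∫ t, ‖weilMellin g (1 / 2 + t * I)‖ ^ 2 ∂μ : ℝ) : ℂ))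
    {k : ℝ → ℂ} (hk : IsWeilTest k) {a : ℝ} (ha : a < 2 * b) (hkt : tsupport k ⊆ Icc (-a) a)
    (hreal : ∀ u : ℝ, (weilMellin k (1 / 2 + u * I)).im = 0) :
    Integrable (fun t : ℝ ↦ (weilMellin k (1 / 2 + t * I)).re) μ ∧
      weilFunctionalChar χ k = ((∫ t, (weilMellin k (1 / 2 + t * I)).re ∂μ : ℝ) : ℂ) := by
  -- the zero-free kernel of radius `r = min 1 (b/2)`
  set r : ℝ := min 1 (b / 2) with hr
  have hr0 : 0 < r := lt_min one_pos (by linarith)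
  have hr1 : r ≤ 1 := min_le_left _ _
  have hrb : 2 * r ≤ b := by have := min_le_right 1 (b / 2); linarith
  obtain ⟨κ, hκc, hκs, hκ⟩ := exists_zeroFree_kernel hr0 hr1
  have hκcs : HasCompactSupport κ := isCompact_Icc.of_isClosed_subset (isClosed_tsupport _) hκs
  obtain ⟨D, hD0, hD⟩ := exists_norm_weilMellin_le_sq hk
  set c : ℝ := D / r with hc
  have hc0 : 0 ≤ c := div_nonneg hD0 hr0.le
  -- the two kernels `κc = c κ` and `kk = k + c κ`
  set κc : ℝ → ℂ := fun x ↦ (c : ℂ) * κ x with hκcdef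
  have hκcc : Continuous κc := continuous_const.mul hκc
  set a' : ℝ := max a (2 * r) with ha'
  have ha'b : a' < 2 * b := max_lt ha (by linarith)
  have hκct : tsupport κc ⊆ Icc (-a') a' := by
    refine (closure_minimal (fun x hx ↦ ?_) (isClosed_tsupport κ)).trans
      (hκs.trans (Icc_subset_Icc (by simp [ha']) (le_max_right _ _)))
    rw [Function.mem_support] at hx
    exact subset_tsupport _ (Function.mem_support.2 fun h ↦ hx (by simp [hκcdef, h]))
  have hκccs : HasCompactSupport κc := isCompact_Icc.of_isClosed_subset (isClosed_tsupport _) hκct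
  have hkt' : tsupport k ⊆ Icc (-a') a' := hkt.trans (Icc_subset_Icc (by simp [ha']) (le_max_left _ _))
  have hkkt : tsupport (k + κc) ⊆ Icc (-a') a' := (tsupport_add _ _).trans (union_subset hkt' hκct)
  have hkkc : Continuous (k + κc) := hk.1.continuous.add hκcc
  -- transforms on the line
  have hκc_line : ∀ u : ℝ, weilMellin κc (1 / 2 + u * I) = (c : ℂ) * weilMellin κ (1 / 2 + u * I) :=
    fun u ↦ weilMellin_const_mul _ _ _
  have hkk_line : ∀ u : ℝ, weilMellin (k + κc) (1 / 2 + u * I) =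
      weilMellin k (1 / 2 + u * I) + (c : ℂ) * weilMellin κ (1 / 2 + u * I) := fun u ↦ by
    rw [weilMellin_add hk.1.continuous hk.2 hκcc hκccs, hκc_line]
  -- decay and sign of `κc`
  have hκc_dec : ∀ u : ℝ, ‖weilMellin κc (1 / 2 + u * I)‖ ≤ (36 * c / r) / (1 + u ^ 2) := fun u ↦ by
    rw [hκc_line, norm_mul, Complex.norm_real, Real.norm_eq_abs, abs_of_nonneg hc0]
    calc c * ‖weilMellin κ (1 / 2 + u * I)‖ ≤ c * (36 / (r * (1 + u ^ 2))) :=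
          mul_le_mul_of_nonneg_left (hκ u).2.2 hc0
      _ = 36 * c / r / (1 + u ^ 2) := by
          field_simp
  have hκc_pos : ∀ u : ℝ, (weilMellin κc (1 / 2 + u * I)).im = 0 ∧
      0 ≤ (weilMellin κc (1 / 2 + u * I)).re := fun u ↦ by
    rw [hκc_line, Complex.re_ofReal_mul, Complex.im_ofReal_mul, (hκ u).1, mul_zero]
    exact ⟨rfl, mul_nonneg hc0 (le_trans (by positivity) (hκ u).2.1)⟩
  -- decay and sign of `kk`
  have hkk_dec : ∀ u : ℝ, ‖weilMellin (k + κc) (1 / 2 + u * I)‖ ≤ (D + 36 * c / r) / (1 + u ^ 2) :=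
    fun u ↦ by
      rw [hkk_line, ← hκc_line]
      refine (norm_add_le _ _).trans ?_
      rw [add_div]
      refine add_le_add ((hD u).trans ?_) (hκc_dec u)
      rw [div_le_div_iff₀ (by positivity) (by positivity)]
      have : 1 + u ^ 2 ≤ (1 + u ^ 2) ^ 2 := by nlinarith [sq_nonneg u]
      nlinarith
  have hkk_pos : ∀ u : ℝ, (weilMellin (k + κc) (1 / 2 + u * I)).im = 0 ∧
      0 ≤ (weilMellin (k + κc) (1 / 2 + u * I)).re := fun u ↦ by
    rw [hkk_line, Complex.add_im, Complex.add_re, Complex.re_ofReal_mul, Complex.im_ofReal_mul,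
      (hκ u).1, hreal u, mul_zero, add_zero]
    refine ⟨rfl, ?_⟩
    have h1 : -(D / (1 + u ^ 2) ^ 2) ≤ (weilMellin k (1 / 2 + u * I)).re := by
      have := (abs_le.1 ((Complex.abs_re_le_norm _).trans (hD u))).1
      linarith
    have h2 : D / (1 + u ^ 2) ^ 2 ≤ c * (weilMellin κ (1 / 2 + u * I)).re := by
      calc D / (1 + u ^ 2) ^ 2 = c * (r / (1 + u ^ 2) ^ 2) := by
            rw [hc]; field_simp
        _ ≤ c * (weilMellin κ (1 / 2 + u * I)).re := mul_le_mul_of_nonneg_left (hκ u).2.1 hc0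
    linarith
  -- the kernel lemma, twice
  obtain ⟨hIkk, hWkk⟩ := weilFunctionalChar_kernel_eq_integral χ hb hμ hkkc ha'b hkkt hkk_dec hkk_pos
  obtain ⟨hIκc, hWκc⟩ := weilFunctionalChar_kernel_eq_integral χ hb hμ hκcc ha'b hκct hκc_dec hκc_pos
  simp only [hkk_line, Complex.add_re, Complex.re_ofReal_mul] at hIkk hWkk
  simp only [hκc_line, Complex.re_ofReal_mul] at hIκc hWκc
  -- additivity and subtraction
  have hAk : Integrable (fun t : ℝ ↦ weilMellin k (1 / 2 + t * I) *
      ((Complex.digamma (1 / 4 + (charParity χ : ℂ) / 2 + t / 2 * I)).re : ℂ)) :=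
    integrable_archChar_of_decay (charParity χ) hk.1.continuous hk.2 (M := D) fun u ↦ (hD u).trans (by
      rw [div_le_div_iff₀ (by positivity) (by positivity)]
      have : 1 + u ^ 2 ≤ (1 + u ^ 2) ^ 2 := by nlinarith [sq_nonneg u]
      nlinarith)
  have hAκc := integrable_archChar_of_decay (charParity χ) hκcc hκccs hκc_dec
  have hadd := weilFunctionalChar_add_of_continuous χ hk.1.continuous hk.2 hκcc hκccs hAk hAκc
  have hIk : Integrable (fun t : ℝ ↦ (weilMellin k (1 / 2 + t * I)).re) μ :=
    (hIkk.sub hIκc).congr (ae_of_all _ fun t ↦ by simp only [Pi.sub_apply]; ring)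
  refine ⟨hIk, ?_⟩
  have hW : weilFunctionalChar χ k = weilFunctionalChar χ (k + κc) - weilFunctionalChar χ κc := by rw [hadd]; ring
  rw [hW, hWkk, hWκc, ← Complex.ofReal_sub, ← integral_sub hIkk hIκc]
  congr 1
  exact integral_congr_ae (ae_of_all _ fun t ↦ by ring)

/-! ## The general case -/

/-- **The `χ`-window measure reproduces Weil's (11) on every test of the open window.**
If `μ` represents `W_χ` on `[-b, b]` (`b > 0`) then for every smooth test `k` with
`tsupport k ⊆ [-a, a]`, `a < 2b`: `k̂(½+i·) ∈ L¹(μ)` and `∫ k̂(½+it) dμ(t) = W_χ(k)`. -/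
theorem integral_weilMellin_eq_weilFunctionalChar (hb : 0 < b)
    (hμ : ∀ g : ℝ → ℂ, IsWeilTest g → tsupport g ⊆ Icc (-b) b →
      Integrable (fun t : ℝ ↦ ‖weilMellin g (1 / 2 + t * I)‖ ^ 2) μ ∧
        weilQuadraticChar χ g = ((∫ t, ‖weilMellin g (1 / 2 + t * I)‖ ^ 2 ∂μ : ℝ) : ℂ))
    {k : ℝ → ℂ} (hk : IsWeilTest k) {a : ℝ} (ha : a < 2 * b) (hkt : tsupport k ⊆ Icc (-a) a) :
    Integrable (fun t : ℝ ↦ weilMellin k (1 / 2 + t * I)) μ ∧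
      ∫ t, weilMellin k (1 / 2 + t * I) ∂μ = weilFunctionalChar χ k := by
  -- the reflected test and the two hermitian parts
  have hkr : IsWeilTest (weilReflect k) := hk.weilReflect
  have hkrt : tsupport (weilReflect k) ⊆ Icc (-a) a := by
    rw [tsupport_weilReflect]
    intro x hx
    have h := hkt (show -x ∈ tsupport k by simpa using hx)
    simp only [mem_Icc] at h ⊢
    constructor <;> linarith [h.1, h.2]
  set k₁ : ℝ → ℂ := fun x ↦ (1 / 2 : ℂ) * (k + weilReflect k) x with hk₁
  set k₂ : ℝ → ℂ := fun x ↦ (-(I / 2)) * (k + fun y ↦ (-1 : ℂ) * weilReflect k y) x with hk₂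
  have hk₁t : IsWeilTest k₁ := (hk.add hkr).const_mul _
  have hkr' : IsWeilTest (fun y ↦ (-1 : ℂ) * weilReflect k y) := hkr.const_mul _
  have hk₂t : IsWeilTest k₂ := (hk.add hkr').const_mul _
  -- supports
  have hsum₁ : tsupport (k + weilReflect k) ⊆ Icc (-a) a := (tsupport_add _ _).trans (union_subset hkt hkrt)
  have hkr't : tsupport (fun y ↦ (-1 : ℂ) * weilReflect k y) ⊆ Icc (-a) a :=
    (tsupport_mul_subset_right (f := fun _ : ℝ ↦ (-1 : ℂ)) (g := weilReflect k)).trans hkrt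
  have hsum₂ : tsupport (k + fun y ↦ (-1 : ℂ) * weilReflect k y) ⊆ Icc (-a) a :=
    (tsupport_add _ _).trans (union_subset hkt hkr't)
  have hk₁s : tsupport k₁ ⊆ Icc (-a) a :=
    (tsupport_mul_subset_right (f := fun _ : ℝ ↦ (1 / 2 : ℂ)) (g := k + weilReflect k)).trans hsum₁
  have hk₂s : tsupport k₂ ⊆ Icc (-a) a :=
    (tsupport_mul_subset_right (f := fun _ : ℝ ↦ -(I / 2))
      (g := k + fun y ↦ (-1 : ℂ) * weilReflect k y)).trans hsum₂
  -- transforms on the line: `k̂₁ = Re k̂`, `k̂₂ = Im k̂`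
  have hline₁ : ∀ u : ℝ, weilMellin k₁ (1 / 2 + u * I) = ((weilMellin k (1 / 2 + u * I)).re : ℂ) := by
    intro u
    simp only [hk₁]
    rw [weilMellin_const_mul, weilMellin_add hk.1.continuous hk.2 hkr.1.continuous hkr.2,
      WeilBochner.weilMellin_weilReflect_half, Complex.add_conj]
    push_cast; ring
  have hline₂ : ∀ u : ℝ, weilMellin k₂ (1 / 2 + u * I) = ((weilMellin k (1 / 2 + u * I)).im : ℂ) := by
    intro u
    simp only [hk₂]
    rw [weilMellin_const_mul, weilMellin_add hk.1.continuous hk.2 hkr'.1.continuous hkr'.2,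
      weilMellin_const_mul, WeilBochner.weilMellin_weilReflect_half]
    apply Complex.ext
    · simp; ring
    · simp
  -- the hermitian case for both parts
  obtain ⟨hI₁, hW₁⟩ := weilFunctionalChar_eq_integral_of_im_eq_zero χ hb hμ hk₁t ha hk₁s
    (fun u ↦ by rw [hline₁, Complex.ofReal_im])
  obtain ⟨hI₂, hW₂⟩ := weilFunctionalChar_eq_integral_of_im_eq_zero χ hb hμ hk₂t ha hk₂s
    (fun u ↦ by rw [hline₂, Complex.ofReal_im])
  simp only [hline₁, hline₂, Complex.ofReal_re] at hI₁ hW₁ hI₂ hW₂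
  -- `k = k₁ + i k₂`
  have hdecomp : k = k₁ + fun x ↦ I * k₂ x := by
    funext x
    simp only [hk₁, hk₂, Pi.add_apply]
    ring_nf
    rw [Complex.I_sq]
    ring
  have hWk : weilFunctionalChar χ k = weilFunctionalChar χ k₁ + I * weilFunctionalChar χ k₂ := by
    conv_lhs => rw [hdecomp]
    rw [WeilBochnerChar.weilFunctionalChar_add χ hk₁t (hk₂t.const_mul I),
      WeilBochnerChar.weilFunctionalChar_const_mul χ I k₂]
  -- integrability and the integral of `k̂ = Re k̂ + i Im k̂`
  have hptw : ∀ t : ℝ, weilMellin k (1 / 2 + t * I) =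
      ((weilMellin k (1 / 2 + t * I)).re : ℂ) + I * ((weilMellin k (1 / 2 + t * I)).im : ℂ) := fun t ↦ by
    rw [mul_comm I]; exact (Complex.re_add_im _).symm
  have hI₁' : Integrable (fun t : ℝ ↦ ((weilMellin k (1 / 2 + t * I)).re : ℂ)) μ := hI₁.ofReal
  have hI₂' : Integrable (fun t : ℝ ↦ ((weilMellin k (1 / 2 + t * I)).im : ℂ)) μ := hI₂.ofReal
  have hI₂'' : Integrable (fun t : ℝ ↦ I * ((weilMellin k (1 / 2 + t * I)).im : ℂ)) μ :=
    hI₂'.const_mul I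
  have hInt : Integrable (fun t : ℝ ↦ weilMellin k (1 / 2 + t * I)) μ := by
    refine (hI₁'.add hI₂'').congr (ae_of_all _ fun t ↦ ?_)
    simp only [Pi.add_apply]
    exact (hptw t).symm
  refine ⟨hInt, ?_⟩
  rw [hWk, hW₁, hW₂, integral_congr_ae (ae_of_all _ hptw), integral_add hI₁' hI₂'',
    integral_const_mul, integral_complex_ofReal, integral_complex_ofReal]

/-- **Determinacy (χ).**  Two measures representing `W_χ` on windows `b₁, b₂`
integrate every test transform of prime-side support `< 2 min b₁ b₂` identically (both equal `W(k)`):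
their difference is a (signed) measure whose Fourier transform vanishes on that window. -/
theorem integral_weilMellin_eq_integral_weilMellin_char {b₁ b₂ : ℝ} {μ₁ μ₂ : Measure ℝ}
    (hb₁ : 0 < b₁) (hb₂ : 0 < b₂)
    (hμ₁ : ∀ g : ℝ → ℂ, IsWeilTest g → tsupport g ⊆ Icc (-b₁) b₁ →
      Integrable (fun t : ℝ ↦ ‖weilMellin g (1 / 2 + t * I)‖ ^ 2) μ₁ ∧
        weilQuadraticChar χ g = ((∫ t, ‖weilMellin g (1 / 2 + t * I)‖ ^ 2 ∂μ₁ : ℝ) : ℂ))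
    (hμ₂ : ∀ g : ℝ → ℂ, IsWeilTest g → tsupport g ⊆ Icc (-b₂) b₂ →
      Integrable (fun t : ℝ ↦ ‖weilMellin g (1 / 2 + t * I)‖ ^ 2) μ₂ ∧
        weilQuadraticChar χ g = ((∫ t, ‖weilMellin g (1 / 2 + t * I)‖ ^ 2 ∂μ₂ : ℝ) : ℂ))
    {k : ℝ → ℂ} (hk : IsWeilTest k) {a : ℝ} (ha : a < 2 * min b₁ b₂)
    (hkt : tsupport k ⊆ Icc (-a) a) :
    ∫ t, weilMellin k (1 / 2 + t * I) ∂μ₁ = ∫ t, weilMellin k (1 / 2 + t * I) ∂μ₂ := by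
  have ha₁ : a < 2 * b₁ := lt_of_lt_of_le ha (by linarith [min_le_left b₁ b₂])
  have ha₂ : a < 2 * b₂ := lt_of_lt_of_le ha (by linarith [min_le_right b₁ b₂])
  rw [(integral_weilMellin_eq_weilFunctionalChar χ hb₁ hμ₁ hk ha₁ hkt).2,
    (integral_weilMellin_eq_weilFunctionalChar χ hb₂ hμ₂ hk ha₂ hkt).2]

/-! ## GRH(χ) ⟺ a positive spectral measure for Weil's (11) -/

/-- **Bochner form of Weil's criterion for `L(s, χ)` (linear functional).**  For a primitive character
`χ` mod `q ≠ 1`: `GRH(χ)` holds iff there is a positive measure `μ` on `ℝ` such that for every smooth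
compactly supported `k` the transform `k̂(½+i·)` is `μ`-integrable and `∫ k̂(½+it) dμ(t) = W_χ(k)`.
(`→`: the zero-height measure of `L(s, χ)` represents the squares,
`WeilBochner.weilQuadraticChar_eq_integral_of_riemannHypothesis`, and the window theorem
`integral_weilMellin_eq_weilFunctionalChar` upgrades to all tests; `←`: `Q_χ(g) = ∫ ‖ĝ‖² dμ ≥ 0`
for every test, then `riemannHypothesis_iff_forall_weilPositivityOnChar_holds`.) -/
theorem grh_iff_exists_spectral_measure [NeZero q] (hq : q ≠ 1) (hprim : χ.IsPrimitive) :
    χ.RiemannHypothesis ↔ ∃ μ : Measure ℝ, ∀ k : ℝ → ℂ, IsWeilTest k →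
      Integrable (fun t : ℝ ↦ weilMellin k (1 / 2 + t * I)) μ ∧
        ∫ t, weilMellin k (1 / 2 + t * I) ∂μ = weilFunctionalChar χ k := by
  constructor
  · intro hGRH
    refine ⟨WeilBochner.charZeroHeightMeasure χ, fun k hk ↦ ?_⟩
    obtain ⟨R, hR0, hR⟩ := WeilContinuous.exists_support_radius hk.2
    have hkt : tsupport k ⊆ Icc (-R) R := by
      refine closure_minimal (fun x hx ↦ ?_) isClosed_Icc
      rw [Function.mem_support] at hx
      by_contra hxR
      rw [mem_Icc, not_and_or, not_le, not_le] at hxR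
      refine hx (hR x ?_)
      rcases hxR with h | h
      · rw [abs_of_neg (show x < 0 by linarith)]; linarith
      · rw [abs_of_pos (show 0 < x by linarith)]; linarith
    exact integral_weilMellin_eq_weilFunctionalChar χ (b := R + 1) (by linarith)
      (fun g hg _ ↦ WeilBochner.weilQuadraticChar_eq_integral_of_riemannHypothesis hq hprim hGRH hg)
      hk (by linarith) hkt
  · rintro ⟨μ, hμ⟩
    rw [riemannHypothesis_iff_forall_weilPositivityOnChar_holds hq hprim]
    intro a g hg hgs
    obtain ⟨-, hW⟩ := hμ _ (hg.weilConv hg.weilReflect)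
    have hline : ∀ t : ℝ, weilMellin (weilConv g (weilReflect g)) (1 / 2 + t * I) =
        ((‖weilMellin g (1 / 2 + t * I)‖ ^ 2 : ℝ) : ℂ) := fun t ↦ weilMellin_weilConv_weilReflect_half hg t
    simp_rw [hline] at hW
    rw [weilQuadraticChar, ← hW, integral_complex_ofReal, Complex.ofReal_re]
    exact integral_nonneg fun t ↦ by positivity

end Summit.RiemannHypothesis.RiemannHypothesis.Theorems.WeilBochnerMeasureChar

end
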